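import Literature.NumberTheory.LFunctions.NymanBeurlingProofs
import Mathlib.Analysis.MellinInversion
import Mathlib.Analysis.SpecialFunctions.Gamma.Deligne
import HarnessLib

/-!
# Burnol's vectors for the Nyman–Beurling lower bound, on the Mellin side

Support for the proof of the Báez-Duarte–Balazard–Landreau–Saias lower bound
`liminf_{λ→0} D(λ)√(log(1/λ)) ≥ √(∑_ρ 1/|ρ|²)` (Burnol 2002, Thm. 1.2; the tree's named fact
`Literature.Barriers.RiemannHypothesis.BDBLS2000_thm`). Burnol (§4–5) controls `D(λ)`, the
`L²(0,∞)`-distance from `χ = 𝟙_{(0,1]}` to the span `𝓑_λ` of `t ↦ {θ/t}`, `λ ≤ θ ≤ 1`, by Hilbert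
space vectors `Y^λ_{ρ,k} ⊥ 𝓑_λ` attached to the zeros `ρ` of `ζ` on the critical line, built with
Báez-Duarte's invariant unitary operators. We realise the `k = 0` vectors directly through their
Mellin transforms on the critical line `s = 1/2 + iτ`, which avoids the `L²`-Mellin operator
calculus: with

* `gammaRatio s = Γ_ℝ(s)/Γ_ℝ(1-s)` (so `ζ(1-s) = gammaRatio(s) ζ(s)`, `|gammaRatio| = 1` on the line),
* `burnolV s = gammaRatio(s) · (s/(s-1))⁶` (Burnol's `V(s) = (s/(1-s))³ ζ(1-s)/ζ(s)` with the
  exponent `3` replaced by `6`, which buys absolute convergence everywhere below),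
* `burnolR s = (s-1)/s⁴`,

the vector attached to a zero `ρ` (on the line) and to `λ ∈ (0,1)` has Mellin transform
`conj (burnolK ρ λ s)`, `burnolK ρ λ s = ((V(s)/V(ρ)) λ^{ρ-s} - 1) · r(s)/(s-ρ)`, an
`L¹ ∩ L²` function of `τ`; the vector itself is `mellinInv (1/2)` of that.

This file: the definitions, the functional equation in `gammaRatio` form, unimodularity of
`gammaRatio` and `burnolV` on the critical line, holomorphy in the strip, and the two pieces of
`L²(0,∞)` bookkeeping for inverse Mellin transforms of `L¹ ∩ L²` data on the critical line:
the absolutely convergent Parseval pairing `∫_0^∞ g · conj(𝓜⁻¹M) = (1/2π) ∫ 𝓜g · conj M`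
(`integral_mul_conj_mellinInv`) and the Plancherel identity
`∫_0^∞ |𝓜⁻¹M|² = (1/2π) ∫ |M|²` (`integral_norm_sq_mellinInv`, from the tree's
`Literature.Analysis.FunctionSpaces.integral_norm_sq_fourierIntegral_eq`). Orthogonality to
`𝓑_λ` and the asymptotics are in the sibling files `NymanBeurlingVectorsOrthogonal.lean`,
`NymanBeurlingVectorsAsymptotics.lean`.

## References

* J.-F. Burnol, *A lower bound in an approximation problem involving the zeros of the Riemann
  zeta function*, Adv. Math. 170 (2002), 56–70; arXiv:math/0103058, §4 (Thm. 4.2, Cor. 4.3), §5.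
* L. Báez-Duarte, M. Balazard, B. Landreau, E. Saias, *Notes sur la fonction ζ de Riemann, 3*,
  Adv. Math. 149 (2000), 130–144.
* E. C. Titchmarsh, *Introduction to the Theory of Fourier Integrals*, 2nd ed., 1948, Thms. 71–72
  (Parseval/Plancherel for Mellin transforms).
-/

noncomputable section

open Complex Filter MeasureTheory Set
open scoped Real Topology FourierTransform ComplexConjugate

namespace Literature.NumberTheory.LFunctions

namespace BurnolVectors

/-! ## The Gamma factor of the functional equation -/

/-- `gammaRatio s = Γ_ℝ(s) / Γ_ℝ(1-s)` with `Γ_ℝ(s) = π^{-s/2} Γ(s/2)` (Mathlib's `Gammaℝ`); the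
functional equation reads `ζ(1-s) = gammaRatio(s) ζ(s)`. Written with `(Γ_ℝ(1-s))⁻¹`, an entire
function. [folklore] -/
def gammaRatio (s : ℂ) : ℂ :=
  Gammaℝ s * (Gammaℝ (1 - s))⁻¹

/-- **Functional equation in the critical strip**: `ζ(1-s) = gammaRatio(s) · ζ(s)` for
`0 < re s < 1` (from `Λ(1-s) = Λ(s)`, Mathlib `completedRiemannZeta_one_sub`, and
`ζ = Λ/Γ_ℝ` away from `0`). [cite: Titchmarsh1986, §2.1 (2.1.1) and (2.6.4)] -/
theorem riemannZeta_one_sub_eq {s : ℂ} (hs0 : 0 < s.re) (hs1 : s.re < 1) :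
    riemannZeta (1 - s) = gammaRatio s * riemannZeta s := by
  have hs : s ≠ 0 := fun h ↦ by simp [h] at hs0
  have hs' : 1 - s ≠ 0 := fun h ↦ by
    have := congrArg Complex.re h; simp at this; linarith
  have hG : Gammaℝ s ≠ 0 := Gammaℝ_ne_zero_of_re_pos hs0
  have hG' : Gammaℝ (1 - s) ≠ 0 := Gammaℝ_ne_zero_of_re_pos (by simp; linarith)
  rw [riemannZeta_def_of_ne_zero hs', completedRiemannZeta_one_sub, riemannZeta_def_of_ne_zero hs,
    gammaRatio]
  field_simp

/-- On the critical line `1 - s = conj s`. [folklore] -/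
lemma one_sub_eq_conj (τ : ℝ) : 1 - ((1 / 2 : ℂ) + τ * I) = conj ((1 / 2 : ℂ) + τ * I) := by
  apply Complex.ext <;> norm_num

/-- `Γ_ℝ(conj s) = conj (Γ_ℝ(s))`. [folklore] -/
private lemma Gammaℝ_conj (s : ℂ) : Gammaℝ (conj s) = conj (Gammaℝ s) := by
  rw [Gammaℝ_def, Gammaℝ_def, map_mul, ← Complex.Gamma_conj, map_div₀, Complex.conj_ofNat]
  congr 1
  have hπ : ((π : ℝ) : ℂ).arg ≠ π := by
    rw [arg_ofReal_of_nonneg Real.pi_pos.le]; exact Real.pi_ne_zero.symm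
  rw [show -conj s / 2 = conj (-s / 2) by simp [map_div₀, Complex.conj_ofNat], cpow_conj _ _ hπ,
    Complex.conj_ofReal]

/-- **`|gammaRatio| = 1` on the critical line**: `Γ_ℝ(1-s) = Γ_ℝ(conj s) = conj Γ_ℝ(s)` for
`re s = 1/2`. [folklore] -/
theorem norm_gammaRatio_line (τ : ℝ) : ‖gammaRatio ((1 / 2 : ℂ) + τ * I)‖ = 1 := by
  have hG : Gammaℝ ((1 / 2 : ℂ) + τ * I) ≠ 0 := Gammaℝ_ne_zero_of_re_pos (by simp)
  rw [gammaRatio, one_sub_eq_conj, Gammaℝ_conj, norm_mul, norm_inv, RCLike.norm_conj,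
    mul_inv_cancel₀ (norm_ne_zero_iff.2 hG)]

/-- `gammaRatio` is complex differentiable on `0 < re s` (poles of `Γ_ℝ` are at `0, -2, …`;
`(Γ_ℝ(1-s))⁻¹` is entire). [folklore] -/
theorem differentiableAt_gammaRatio {s : ℂ} (hs : 0 < s.re) : DifferentiableAt ℂ gammaRatio s := by
  unfold gammaRatio
  refine DifferentiableAt.mul ?_ ?_
  · rw [show Gammaℝ = fun s ↦ (π : ℂ) ^ (-s / 2) * Gamma (s / 2) from funext Gammaℝ_def]
    refine DifferentiableAt.mul ?_ ?_
    · refine DifferentiableAt.const_cpow (by fun_prop) (Or.inl (by exact_mod_cast Real.pi_ne_zero))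
    · refine (differentiableAt_Gamma _ fun m h ↦ ?_).comp s (by fun_prop)
      have := congrArg Complex.re h
      simp at this
      linarith [m.cast_nonneg (α := ℝ)]
  · exact (differentiable_Gammaℝ_inv.comp (by fun_prop : Differentiable ℂ fun s : ℂ ↦ 1 - s)) s

/-- `gammaRatio s ≠ 0` for `0 < re s < 1`. [folklore] -/
theorem gammaRatio_ne_zero {s : ℂ} (hs0 : 0 < s.re) (hs1 : s.re < 1) : gammaRatio s ≠ 0 := by
  unfold gammaRatio
  exact mul_ne_zero (Gammaℝ_ne_zero_of_re_pos hs0)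
    (inv_ne_zero (Gammaℝ_ne_zero_of_re_pos (by simp; linarith)))

/-! ## Burnol's multiplier `V` and the weight `r` -/

/-- Burnol's unimodular multiplier, here `V(s) = gammaRatio(s) · (s/(s-1))⁶` (Burnol uses
`(s/(1-s))³ ζ(1-s)/ζ(s)`; any `(s/(s-1))^m`, `m ≥ 3`, works, and `m = 6` keeps every contour
integral below absolutely convergent). [cite: Burnol2002, §4 (definition of V)] -/
def burnolV (s : ℂ) : ℂ :=
  gammaRatio s * (s / (s - 1)) ^ 6

/-- The weight `r(s) = (s-1)/s⁴`: it vanishes at `s = 1` (killing the pole of `ζ`), is `O(|s|⁻³)`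
on vertical lines, and has `|r(s)| = |s|⁻³` on the critical line (Burnol's `χ₁ = (1 + log t)χ`,
`χ̂₁ = (s-1)/s²`, corresponds to the weight `(s-1)/s`). [cite: Burnol2002, §4] -/
def burnolR (s : ℂ) : ℂ :=
  (s - 1) / s ^ 4

/-- On the critical line `‖s‖ = ‖s - 1‖`. [folklore] -/
lemma norm_line_eq_norm_sub_one (τ : ℝ) :
    ‖(1 / 2 : ℂ) + τ * I‖ = ‖(1 / 2 : ℂ) + τ * I - 1‖ := by
  have h1 : ‖(1 / 2 : ℂ) + τ * I‖ ^ 2 = 1 / 4 + τ ^ 2 := by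
    rw [Complex.sq_norm, show (1 / 2 : ℂ) + τ * I = ((1 / 2 : ℝ) : ℂ) + τ * I by push_cast; ring,
      normSq_add_mul_I]; ring
  have h2 : ‖(1 / 2 : ℂ) + τ * I - 1‖ ^ 2 = 1 / 4 + τ ^ 2 := by
    rw [Complex.sq_norm, show (1 / 2 : ℂ) + τ * I - 1 = ((-(1 / 2) : ℝ) : ℂ) + τ * I by
      push_cast; ring, normSq_add_mul_I]; ring
  nlinarith [norm_nonneg ((1 / 2 : ℂ) + τ * I), norm_nonneg ((1 / 2 : ℂ) + τ * I - 1)]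

/-- Points of the critical line are `≠ 0`. [folklore] -/
lemma line_ne_zero (τ : ℝ) : (1 / 2 : ℂ) + τ * I ≠ 0 := fun h ↦ by
  have := congrArg Complex.re h; simp at this

/-- Points of the critical line are `≠ 1`. [folklore] -/
lemma line_ne_one (τ : ℝ) : (1 / 2 : ℂ) + τ * I ≠ 1 := fun h ↦ by
  have := congrArg Complex.re h; norm_num at this

/-- `‖s‖ ≥ 1/2` on the critical line. [folklore] -/
lemma half_le_norm_line (τ : ℝ) : 1 / 2 ≤ ‖(1 / 2 : ℂ) + τ * I‖ := by
  have := abs_re_le_norm ((1 / 2 : ℂ) + τ * I)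
  norm_num at this
  norm_num
  exact this

/-- **`|V| = 1` on the critical line.** [cite: Burnol2002, §4] -/
theorem norm_burnolV_line (τ : ℝ) : ‖burnolV ((1 / 2 : ℂ) + τ * I)‖ = 1 := by
  rw [burnolV, norm_mul, norm_gammaRatio_line, one_mul, norm_pow, norm_div,
    ← norm_line_eq_norm_sub_one, div_self (norm_ne_zero_iff.2 (line_ne_zero τ)), one_pow]

/-- `V` is complex differentiable on `0 < re s < 1`. [folklore] -/
theorem differentiableAt_burnolV {s : ℂ} (hs0 : 0 < s.re) (hs1 : s.re < 1) :
    DifferentiableAt ℂ burnolV s := by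
  have h1 : s - 1 ≠ 0 := fun h ↦ by
    have := congrArg Complex.re h; simp at this; linarith
  have h2' : DifferentiableAt ℂ (fun z : ℂ ↦ z / (z - 1)) s :=
    DifferentiableAt.div differentiableAt_id (differentiableAt_id.sub_const 1) h1
  have h2 : DifferentiableAt ℂ (fun z : ℂ ↦ (z / (z - 1)) ^ 6) s := h2'.pow 6
  have h3 : burnolV = fun z ↦ gammaRatio z * (z / (z - 1)) ^ 6 := rfl
  rw [h3]
  exact (differentiableAt_gammaRatio hs0).mul h2

/-- `V(s) ≠ 0` for `0 < re s < 1`. [folklore] -/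
theorem burnolV_ne_zero {s : ℂ} (hs0 : 0 < s.re) (hs1 : s.re < 1) : burnolV s ≠ 0 := by
  have h0 : s ≠ 0 := fun h ↦ by simp [h] at hs0
  have h1 : s - 1 ≠ 0 := fun h ↦ by
    have := congrArg Complex.re h; simp at this; linarith
  unfold burnolV
  exact mul_ne_zero (gammaRatio_ne_zero hs0 hs1) (pow_ne_zero _ (div_ne_zero h0 h1))

/-- `‖r(s)‖ = ‖s‖⁻³` on the critical line. [folklore] -/
theorem norm_burnolR_line (τ : ℝ) :
    ‖burnolR ((1 / 2 : ℂ) + τ * I)‖ = ‖(1 / 2 : ℂ) + τ * I‖⁻¹ ^ 3 := by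
  have h0 : ‖(1 / 2 : ℂ) + τ * I‖ ≠ 0 := norm_ne_zero_iff.2 (line_ne_zero τ)
  rw [burnolR, norm_div, ← norm_line_eq_norm_sub_one, norm_pow]
  field_simp

/-- `‖r(s)‖ ≤ 8` on the critical line. [folklore] -/
theorem norm_burnolR_line_le (τ : ℝ) : ‖burnolR ((1 / 2 : ℂ) + τ * I)‖ ≤ 8 := by
  rw [norm_burnolR_line]
  have h := half_le_norm_line τ
  have h2 : ‖(1 / 2 : ℂ) + τ * I‖⁻¹ ≤ 2 := by
    rw [inv_le_comm₀ (by linarith) (by norm_num)]; linarith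
  calc ‖(1 / 2 : ℂ) + τ * I‖⁻¹ ^ 3 ≤ 2 ^ 3 := by gcongr
    _ = 8 := by norm_num

/-! ## The Mellin data `k` of Burnol's vector -/

/-- The Mellin-side datum of the (`k = 0`) Burnol vector attached to a zero `ρ` and a parameter
`λ`: `burnolK ρ λ s = ((V(s)/V(ρ)) λ^{ρ-s} - 1) · r(s) / (s - ρ)`. On the critical line, with
`ρ = 1/2 + iγ` a zero of `ζ` and `0 < λ < 1`, it is `O(1/τ⁴)`, has a removable singularity at
`s = ρ` (Lean reads the junk value `0` there, a null set), and its conjugate is the Mellin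
transform of a vector orthogonal to every `t ↦ {θ/t}`, `λ ≤ θ ≤ 1`. [cite: Burnol2002, Thm. 4.2 and Definition 5.1] -/
def burnolK (ρ : ℂ) (lam : ℝ) (s : ℂ) : ℂ :=
  (burnolV s / burnolV ρ * (lam : ℂ) ^ (ρ - s) - 1) * burnolR s / (s - ρ)


/-! ## The decomposition `k = k₁ + k₂` and bounds on the critical line -/

/-- The model part `k₁(s) = (λ^{ρ-s} - 1) · r(s)/(s-ρ)` of `burnolK` (on the line:
`(e^{iuL} - 1) r(s)/(iu)`, `u = τ - γ`, `L = log(1/λ)`). [cite: Burnol2002, §5] -/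
def burnolK1 (ρ : ℂ) (lam : ℝ) (s : ℂ) : ℂ :=
  ((lam : ℂ) ^ (ρ - s) - 1) * burnolR s / (s - ρ)

/-- The remainder part `k₂(s) = (V(s)/V(ρ) - 1) λ^{ρ-s} · r(s)/(s-ρ)` of `burnolK` (bounded near
`s = ρ` uniformly in `λ`). [cite: Burnol2002, §5] -/
def burnolK2 (ρ : ℂ) (lam : ℝ) (s : ℂ) : ℂ :=
  (burnolV s / burnolV ρ - 1) * (lam : ℂ) ^ (ρ - s) * burnolR s / (s - ρ)

/-- `k = k₁ + k₂`. [folklore] -/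
theorem burnolK_eq_add (ρ : ℂ) (lam : ℝ) (s : ℂ) :
    burnolK ρ lam s = burnolK1 ρ lam s + burnolK2 ρ lam s := by
  simp only [burnolK, burnolK1, burnolK2]
  ring

/-- On the critical line `λ^{ρ-s} = e^{i(τ-γ)L}` with `L = -log λ`: for `ρ = 1/2+iγ`,
`s = 1/2+iτ`, `λ > 0`. [folklore] -/
theorem cpow_rho_sub_line {lam : ℝ} (hlam : 0 < lam) (γ τ : ℝ) :
    (lam : ℂ) ^ (((1 / 2 : ℂ) + γ * I) - ((1 / 2 : ℂ) + τ * I)) =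
      Complex.exp ((((τ - γ) * -Real.log lam : ℝ) : ℂ) * I) := by
  rw [cpow_def_of_ne_zero (by exact_mod_cast hlam.ne'), ← Complex.ofReal_log hlam.le]
  congr 1
  push_cast
  ring

/-- `‖λ^{ρ-s}‖ = 1` for `ρ, s` on the critical line and `λ > 0`. [folklore] -/
theorem norm_cpow_rho_sub_line {lam : ℝ} (hlam : 0 < lam) (γ τ : ℝ) :
    ‖(lam : ℂ) ^ (((1 / 2 : ℂ) + γ * I) - ((1 / 2 : ℂ) + τ * I))‖ = 1 := by
  rw [cpow_rho_sub_line hlam, norm_exp_ofReal_mul_I]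

/-- `‖λ^{ρ-s} - 1‖ ≤ min 2 (L|τ-γ|)` on the line (`L = -log λ`, `0 < λ < 1`). [folklore] -/
theorem norm_cpow_rho_sub_line_sub_one_le {lam : ℝ} (hlam : 0 < lam) (γ τ : ℝ) :
    ‖(lam : ℂ) ^ (((1 / 2 : ℂ) + γ * I) - ((1 / 2 : ℂ) + τ * I)) - 1‖ ≤
      min 2 (|Real.log lam| * |τ - γ|) := by
  refine le_min ?_ ?_
  · calc ‖(lam : ℂ) ^ (((1 / 2 : ℂ) + γ * I) - ((1 / 2 : ℂ) + τ * I)) - 1‖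
        ≤ ‖(lam : ℂ) ^ (((1 / 2 : ℂ) + γ * I) - ((1 / 2 : ℂ) + τ * I))‖ + ‖(1 : ℂ)‖ :=
          norm_sub_le _ _
      _ = 2 := by rw [norm_cpow_rho_sub_line hlam, norm_one]; norm_num
  · rw [cpow_rho_sub_line hlam, mul_comm _ I]
    refine Real.norm_exp_I_mul_ofReal_sub_one_le.trans ?_
    rw [Real.norm_eq_abs, abs_mul, abs_neg, mul_comm]

/-- `V` is continuous along the critical line. [folklore] -/
theorem continuous_burnolV_line : Continuous fun τ : ℝ ↦ burnolV ((1 / 2 : ℂ) + τ * I) := by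
  have hline : Continuous fun τ : ℝ ↦ (1 / 2 : ℂ) + τ * I := by fun_prop
  refine continuous_iff_continuousAt.2 fun τ ↦ ?_
  exact (differentiableAt_burnolV (by simp) (by simp; norm_num)).continuousAt.comp hline.continuousAt

/-- `r` is continuous along the critical line. [folklore] -/
theorem continuous_burnolR_line : Continuous fun τ : ℝ ↦ burnolR ((1 / 2 : ℂ) + τ * I) := by
  unfold burnolR
  refine Continuous.div (by fun_prop) (by fun_prop) fun τ ↦ pow_ne_zero _ (line_ne_zero τ)

/-- **A Lipschitz bound for `V` at a point of the critical line**: there is `D` with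
`‖V(1/2+iτ)/V(1/2+iγ) - 1‖ ≤ D |τ - γ|` for all real `τ` (`V` is holomorphic near the line and
unimodular on it). [folklore] -/
theorem exists_norm_burnolV_div_sub_one_le (γ : ℝ) :
    ∃ D : ℝ, 0 < D ∧ ∀ τ : ℝ,
      ‖burnolV ((1 / 2 : ℂ) + τ * I) / burnolV ((1 / 2 : ℂ) + γ * I) - 1‖ ≤ D * |τ - γ| := by
  set ρ : ℂ := (1 / 2 : ℂ) + γ * I with hρ
  -- `V` is holomorphic on the open strip, hence `deriv V` is continuous there
  set U : Set ℂ := {z : ℂ | 1 / 4 < z.re ∧ z.re < 3 / 4} with hU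
  have hUo : IsOpen U :=
    (isOpen_lt continuous_const continuous_re).inter (isOpen_lt continuous_re continuous_const)
  have hdiff : DifferentiableOn ℂ burnolV U := fun z hz ↦
    (differentiableAt_burnolV (by linarith [hz.1]) (by linarith [hz.2])).differentiableWithinAt
  have hderiv_cont : ContinuousOn (deriv burnolV) U :=
    (hdiff.analyticOnNhd hUo).deriv.continuousOn
  -- bound `deriv V` on the compact ball of radius `1/8` about `ρ`
  set B : Set ℂ := Metric.closedBall ρ (1 / 8) with hB
  have hBU : B ⊆ U := by
    intro z hz
    have h1 : |z.re - ρ.re| ≤ ‖z - ρ‖ := by simpa using abs_re_le_norm (z - ρ)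
    have h2 : ‖z - ρ‖ ≤ 1 / 8 := mem_closedBall_iff_norm.1 hz
    have h3 : ρ.re = 1 / 2 := by simp [hρ]
    rw [h3] at h1
    constructor <;> [linarith [(abs_le.1 (h1.trans h2)).1]; linarith [(abs_le.1 (h1.trans h2)).2]]
  obtain ⟨C, hC⟩ := (isCompact_closedBall ρ (1 / 8)).exists_bound_of_continuousOn
    (hderiv_cont.mono hBU)
  have hC0 : 0 ≤ C := (norm_nonneg _).trans (hC ρ (Metric.mem_closedBall_self (by norm_num)))
  have hVρ : ‖burnolV ρ‖ = 1 := norm_burnolV_line γ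
  have hVρ0 : burnolV ρ ≠ 0 := norm_ne_zero_iff.1 (by rw [hVρ]; norm_num)
  refine ⟨max C 16, lt_max_of_lt_right (by norm_num), fun τ ↦ ?_⟩
  have hs : ‖(1 / 2 : ℂ) + τ * I - ρ‖ = |τ - γ| := by
    rw [hρ, show (1 / 2 : ℂ) + τ * I - ((1 / 2 : ℂ) + γ * I) = ((τ - γ : ℝ) : ℂ) * I by
      push_cast; ring, norm_mul, norm_I, mul_one, Complex.norm_real, Real.norm_eq_abs]
  rw [div_sub_one hVρ0, norm_div, hVρ, div_one]
  by_cases hτ : |τ - γ| ≤ 1 / 8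
  · -- mean value inequality on the ball
    have hmem : (1 / 2 : ℂ) + τ * I ∈ B := by
      rw [hB, mem_closedBall_iff_norm, hs]; exact hτ
    have key := (convex_closedBall ρ (1 / 8)).norm_image_sub_le_of_norm_deriv_le
      (fun z hz ↦ hdiff.differentiableAt (hUo.mem_nhds (hBU hz))) hC
      (Metric.mem_closedBall_self (by norm_num)) hmem
    rw [hs] at key
    exact key.trans (mul_le_mul_of_nonneg_right (le_max_left _ _) (abs_nonneg _))
  · rw [not_le] at hτ
    calc ‖burnolV ((1 / 2 : ℂ) + τ * I) - burnolV ρ‖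
        ≤ ‖burnolV ((1 / 2 : ℂ) + τ * I)‖ + ‖burnolV ρ‖ := norm_sub_le _ _
      _ = 2 := by rw [norm_burnolV_line, hVρ]; norm_num
      _ ≤ 16 * |τ - γ| := by linarith
      _ ≤ max C 16 * |τ - γ| := mul_le_mul_of_nonneg_right (le_max_right _ _) (abs_nonneg _)

/-- Distance along the line: `‖(1/2+iτ) - (1/2+iγ)‖ = |τ - γ|`. [folklore] -/
lemma norm_line_sub_line (τ γ : ℝ) : ‖((1 / 2 : ℂ) + τ * I) - ((1 / 2 : ℂ) + γ * I)‖ = |τ - γ| := by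
  rw [show (1 / 2 : ℂ) + τ * I - ((1 / 2 : ℂ) + γ * I) = ((τ - γ : ℝ) : ℂ) * I by push_cast; ring,
    norm_mul, norm_I, mul_one, Complex.norm_real, Real.norm_eq_abs]

/-- **Bound for `k₁` on the line**: `‖k₁(1/2+iτ)‖ ≤ min(L, 2/|τ-γ|) · ‖r(1/2+iτ)‖` where
`L = -log λ`; stated as the two inequalities. [folklore] -/
theorem norm_burnolK1_line_le {lam : ℝ} (hlam : 0 < lam) (γ τ : ℝ) :
    ‖burnolK1 ((1 / 2 : ℂ) + γ * I) lam ((1 / 2 : ℂ) + τ * I)‖ ≤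
        |Real.log lam| * ‖burnolR ((1 / 2 : ℂ) + τ * I)‖ ∧
      ‖burnolK1 ((1 / 2 : ℂ) + γ * I) lam ((1 / 2 : ℂ) + τ * I)‖ ≤
        2 / |τ - γ| * ‖burnolR ((1 / 2 : ℂ) + τ * I)‖ := by
  have h := norm_cpow_rho_sub_line_sub_one_le hlam γ τ
  rw [burnolK1, norm_div, norm_mul, norm_line_sub_line]
  by_cases hu : τ - γ = 0
  · simp [hu]; positivity
  have hu' : 0 < |τ - γ| := abs_pos.2 hu
  constructor
  · rw [div_le_iff₀ hu']
    calc ‖(lam : ℂ) ^ ((1 / 2 : ℂ) + γ * I - ((1 / 2 : ℂ) + τ * I)) - 1‖ * ‖burnolR ((1 / 2 : ℂ) + τ * I)‖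
        ≤ (|Real.log lam| * |τ - γ|) * ‖burnolR ((1 / 2 : ℂ) + τ * I)‖ := by
          gcongr; exact h.trans (min_le_right _ _)
      _ = |Real.log lam| * ‖burnolR ((1 / 2 : ℂ) + τ * I)‖ * |τ - γ| := by ring
  · rw [div_le_iff₀ hu', div_mul_eq_mul_div, div_mul_eq_mul_div, le_div_iff₀ hu']
    gcongr
    exact h.trans (min_le_left _ _)

/-- **Bound for `k₂` on the line**: with `D` from `exists_norm_burnolV_div_sub_one_le`,
`‖k₂(1/2+iτ)‖ ≤ D ‖r(1/2+iτ)‖`, uniformly in `λ ∈ (0,1)`. [folklore] -/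
theorem norm_burnolK2_line_le {lam : ℝ} (hlam : 0 < lam) {γ D : ℝ}
    (hD : ∀ τ : ℝ, ‖burnolV ((1 / 2 : ℂ) + τ * I) / burnolV ((1 / 2 : ℂ) + γ * I) - 1‖ ≤ D * |τ - γ|)
    (τ : ℝ) :
    ‖burnolK2 ((1 / 2 : ℂ) + γ * I) lam ((1 / 2 : ℂ) + τ * I)‖ ≤ D * ‖burnolR ((1 / 2 : ℂ) + τ * I)‖ := by
  have hD0 : 0 ≤ D := by
    have := hD (γ + 1)
    rw [add_sub_cancel_left, abs_one, mul_one] at this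
    exact (norm_nonneg _).trans this
  rw [burnolK2, norm_div, norm_mul, norm_mul, norm_cpow_rho_sub_line hlam, mul_one, norm_line_sub_line]
  by_cases hu : τ - γ = 0
  · simp [hu]; positivity
  have hu' : 0 < |τ - γ| := abs_pos.2 hu
  rw [div_le_iff₀ hu']
  calc ‖burnolV ((1 / 2 : ℂ) + τ * I) / burnolV ((1 / 2 : ℂ) + γ * I) - 1‖ * ‖burnolR ((1 / 2 : ℂ) + τ * I)‖
      ≤ (D * |τ - γ|) * ‖burnolR ((1 / 2 : ℂ) + τ * I)‖ := by gcongr; exact hD τ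
    _ = D * ‖burnolR ((1 / 2 : ℂ) + τ * I)‖ * |τ - γ| := by ring

/-- Decay of the weight on the line: `‖r(1/2+iτ)‖ ≤ 8 (1+τ²)⁻¹`. [folklore] -/
theorem norm_burnolR_line_le_inv (τ : ℝ) : ‖burnolR ((1 / 2 : ℂ) + τ * I)‖ ≤ 8 * (1 + τ ^ 2)⁻¹ := by
  rw [norm_burnolR_line]
  set n : ℝ := ‖(1 / 2 : ℂ) + τ * I‖ with hn
  have hn2 : n ^ 2 = 1 / 4 + τ ^ 2 := by
    rw [hn, Complex.sq_norm, show (1 / 2 : ℂ) + τ * I = ((1 / 2 : ℝ) : ℂ) + τ * I by push_cast; ring,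
      normSq_add_mul_I]; ring
  have hn0 : 1 / 2 ≤ n := half_le_norm_line τ
  have hpos : 0 < n := by linarith
  rw [inv_pow, ← one_div, ← div_eq_mul_inv, div_le_div_iff₀ (by positivity) (by positivity)]
  nlinarith [mul_le_mul_of_nonneg_right hn0 (sq_nonneg n), hn2, sq_nonneg τ]

/-- Measurability of `τ ↦ k₁(1/2+iτ)`. [folklore] -/
theorem measurable_burnolK1_line (γ lam : ℝ) :
    Measurable fun τ : ℝ ↦ burnolK1 ((1 / 2 : ℂ) + γ * I) lam ((1 / 2 : ℂ) + τ * I) := by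
  unfold burnolK1
  refine Measurable.div (Measurable.mul ?_ continuous_burnolR_line.measurable) (by fun_prop)
  exact Measurable.sub (by fun_prop) measurable_const

/-- Measurability of `τ ↦ k₂(1/2+iτ)`. [folklore] -/
theorem measurable_burnolK2_line (γ lam : ℝ) :
    Measurable fun τ : ℝ ↦ burnolK2 ((1 / 2 : ℂ) + γ * I) lam ((1 / 2 : ℂ) + τ * I) := by
  unfold burnolK2
  refine Measurable.div (Measurable.mul (Measurable.mul ?_ ?_) continuous_burnolR_line.measurable)
    (by fun_prop)
  · exact (continuous_burnolV_line.measurable.div_const _).sub measurable_const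
  · fun_prop

/-- Measurability of `τ ↦ k(1/2+iτ)`. [folklore] -/
theorem measurable_burnolK_line (γ lam : ℝ) :
    Measurable fun τ : ℝ ↦ burnolK ((1 / 2 : ℂ) + γ * I) lam ((1 / 2 : ℂ) + τ * I) := by
  have : (fun τ : ℝ ↦ burnolK ((1 / 2 : ℂ) + γ * I) lam ((1 / 2 : ℂ) + τ * I)) = fun τ : ℝ ↦
      burnolK1 ((1 / 2 : ℂ) + γ * I) lam ((1 / 2 : ℂ) + τ * I) +
        burnolK2 ((1 / 2 : ℂ) + γ * I) lam ((1 / 2 : ℂ) + τ * I) := funext fun τ ↦ burnolK_eq_add _ _ _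
  rw [this]
  exact (measurable_burnolK1_line γ lam).add (measurable_burnolK2_line γ lam)

/-- A measurable function on `ℝ` dominated by `C (1+τ²)⁻¹` is integrable and square integrable.
[folklore] -/
theorem integrable_and_memLp_two_of_norm_le {f : ℝ → ℂ} {C : ℝ} (hf : Measurable f)
    (hle : ∀ τ : ℝ, ‖f τ‖ ≤ C * (1 + τ ^ 2)⁻¹) : Integrable f ∧ MemLp f 2 := by
  have hC : 0 ≤ C := by
    have := hle 0; norm_num at this; exact (norm_nonneg _).trans this
  have h1 : Integrable f :=
    Integrable.mono' (integrable_inv_one_add_sq.const_mul C) hf.aestronglyMeasurable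
      (Eventually.of_forall hle)
  refine ⟨h1, (memLp_two_iff_integrable_sq_norm hf.aestronglyMeasurable).2 ?_⟩
  refine Integrable.mono' (integrable_inv_one_add_sq.const_mul (C ^ 2)) (hf.norm.pow_const 2).aestronglyMeasurable
    (Eventually.of_forall fun τ ↦ ?_)
  rw [Real.norm_eq_abs, abs_of_nonneg (by positivity)]
  have h0 : 0 ≤ (1 + τ ^ 2)⁻¹ := by positivity
  have h1' : (1 + τ ^ 2)⁻¹ ≤ 1 := inv_le_one_of_one_le₀ (by nlinarith)
  calc ‖f τ‖ ^ 2 ≤ (C * (1 + τ ^ 2)⁻¹) ^ 2 := by gcongr; exact hle τ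
    _ = C ^ 2 * (1 + τ ^ 2)⁻¹ * (1 + τ ^ 2)⁻¹ := by ring
    _ ≤ C ^ 2 * (1 + τ ^ 2)⁻¹ * 1 := by gcongr
    _ = C ^ 2 * (1 + τ ^ 2)⁻¹ := mul_one _

/-- **`k₁ ∈ L¹ ∩ L²` on the line** (`λ > 0`). [folklore] -/
theorem integrable_burnolK1_line {lam : ℝ} (hlam : 0 < lam) (γ : ℝ) :
    Integrable (fun τ : ℝ ↦ burnolK1 ((1 / 2 : ℂ) + γ * I) lam ((1 / 2 : ℂ) + τ * I)) ∧
      MemLp (fun τ : ℝ ↦ burnolK1 ((1 / 2 : ℂ) + γ * I) lam ((1 / 2 : ℂ) + τ * I)) 2 := by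
  refine integrable_and_memLp_two_of_norm_le (C := |Real.log lam| * 8) (measurable_burnolK1_line γ lam)
    fun τ ↦ ?_
  calc ‖burnolK1 ((1 / 2 : ℂ) + γ * I) lam ((1 / 2 : ℂ) + τ * I)‖
      ≤ |Real.log lam| * ‖burnolR ((1 / 2 : ℂ) + τ * I)‖ := (norm_burnolK1_line_le hlam γ τ).1
    _ ≤ |Real.log lam| * (8 * (1 + τ ^ 2)⁻¹) := by gcongr; exact norm_burnolR_line_le_inv τ
    _ = |Real.log lam| * 8 * (1 + τ ^ 2)⁻¹ := by ring

/-- **`k₂ ∈ L¹ ∩ L²` on the line** (`λ > 0`). [folklore] -/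
theorem integrable_burnolK2_line {lam : ℝ} (hlam : 0 < lam) (γ : ℝ) :
    Integrable (fun τ : ℝ ↦ burnolK2 ((1 / 2 : ℂ) + γ * I) lam ((1 / 2 : ℂ) + τ * I)) ∧
      MemLp (fun τ : ℝ ↦ burnolK2 ((1 / 2 : ℂ) + γ * I) lam ((1 / 2 : ℂ) + τ * I)) 2 := by
  obtain ⟨D, -, hD⟩ := exists_norm_burnolV_div_sub_one_le γ
  refine integrable_and_memLp_two_of_norm_le (C := D * 8) (measurable_burnolK2_line γ lam) fun τ ↦ ?_
  calc ‖burnolK2 ((1 / 2 : ℂ) + γ * I) lam ((1 / 2 : ℂ) + τ * I)‖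
      ≤ D * ‖burnolR ((1 / 2 : ℂ) + τ * I)‖ := norm_burnolK2_line_le hlam hD τ
    _ ≤ D * (8 * (1 + τ ^ 2)⁻¹) := by
        have hD0 : 0 ≤ D := by
          have := hD (γ + 1)
          rw [add_sub_cancel_left, abs_one, mul_one] at this
          exact (norm_nonneg _).trans this
        gcongr; exact norm_burnolR_line_le_inv τ
    _ = D * 8 * (1 + τ ^ 2)⁻¹ := by ring

/-- **`k ∈ L¹ ∩ L²` on the line** (`λ > 0`). [folklore] -/
theorem integrable_burnolK_line {lam : ℝ} (hlam : 0 < lam) (γ : ℝ) :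
    Integrable (fun τ : ℝ ↦ burnolK ((1 / 2 : ℂ) + γ * I) lam ((1 / 2 : ℂ) + τ * I)) ∧
      MemLp (fun τ : ℝ ↦ burnolK ((1 / 2 : ℂ) + γ * I) lam ((1 / 2 : ℂ) + τ * I)) 2 := by
  have e : (fun τ : ℝ ↦ burnolK ((1 / 2 : ℂ) + γ * I) lam ((1 / 2 : ℂ) + τ * I)) = fun τ : ℝ ↦
      burnolK1 ((1 / 2 : ℂ) + γ * I) lam ((1 / 2 : ℂ) + τ * I) +
        burnolK2 ((1 / 2 : ℂ) + γ * I) lam ((1 / 2 : ℂ) + τ * I) := funext fun τ ↦ burnolK_eq_add _ _ _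
  rw [e]
  exact ⟨(integrable_burnolK1_line hlam γ).1.add (integrable_burnolK2_line hlam γ).1,
    (integrable_burnolK1_line hlam γ).2.add (integrable_burnolK2_line hlam γ).2⟩

/-! ## Inverse Mellin transforms of `L¹ ∩ L²` data on the critical line -/

/-- For `t ≥ 0` real, `conj (t^m) = t^{conj m}`. [folklore] -/
private lemma conj_cpow_ofReal {t : ℝ} (ht : 0 ≤ t) (m : ℂ) : conj ((t : ℂ) ^ m) = (t : ℂ) ^ (conj m) := by
  have harg : (t : ℂ).arg ≠ π := by
    rw [arg_ofReal_of_nonneg ht]; exact Real.pi_ne_zero.symm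
  have h := cpow_conj (t : ℂ) m harg
  rw [Complex.conj_ofReal] at h
  exact h.symm

/-- `conj (-(1/2 + iy)) = (1/2 + iy) - 1`. [folklore] -/
lemma conj_neg_line (y : ℝ) : conj (-((1 / 2 : ℂ) + y * I)) = ((1 / 2 : ℂ) + y * I) - 1 := by
  apply Complex.ext <;> norm_num

/-- Pointwise form of the Parseval integrand: for `t > 0`,
`g(t) · conj((𝓜⁻¹M)(t)) = (1/2π) ∫ (t^{s-1} g(t)) · conj(M(s)) dy`, `s = 1/2 + iy`. [folklore] -/
lemma mul_conj_mellinInv_eq (g : ℝ → ℂ) (M : ℂ → ℂ) {t : ℝ} (ht : 0 < t) :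
    g t * conj (mellinInv (1 / 2) M t) = (1 / (2 * π) : ℂ) *
      ∫ y : ℝ, ((t : ℂ) ^ (((1 / 2 : ℂ) + y * I) - 1) • g t) * conj (M ((1 / 2 : ℂ) + y * I)) := by
  rw [mellinInv, Complex.real_smul, map_mul, Complex.conj_ofReal, ← integral_conj, ← mul_assoc,
    mul_comm (g t), mul_assoc, ← integral_const_mul (g t)]
  push_cast
  congr 1
  refine integral_congr_ae (Eventually.of_forall fun y ↦ ?_)
  simp only [smul_eq_mul, map_mul]
  rw [conj_cpow_ofReal ht.le, conj_neg_line]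
  ring

/-- **Parseval's formula for the Mellin transform, absolutely convergent form.** If
`∫_0^∞ |g(t)| t^{-1/2} dt < ∞` and `τ ↦ M(1/2 + iτ)` is integrable, then
`∫_0^∞ g(t) · conj((𝓜⁻¹ M)(t)) dt = (1/2π) ∫ 𝓜g(1/2+iτ) · conj(M(1/2+iτ)) dτ`
(Fubini; Titchmarsh, *Fourier Integrals*, Thm. 72 in the absolutely convergent case).
[folklore] -/
theorem integral_mul_conj_mellinInv {g : ℝ → ℂ} {M : ℂ → ℂ}
    (hg : MellinConvergent g (1 / 2 : ℂ))
    (hM : Integrable fun τ : ℝ ↦ M ((1 / 2 : ℂ) + τ * I)) :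
    ∫ t in Ioi (0 : ℝ), g t * conj (mellinInv (1 / 2) M t) =
      (1 / (2 * π) : ℂ) * ∫ τ : ℝ, mellin g ((1 / 2 : ℂ) + τ * I) * conj (M ((1 / 2 : ℂ) + τ * I)) := by
  set μ0 : Measure ℝ := volume.restrict (Ioi 0) with hμ0
  set F : ℝ → ℝ → ℂ := fun t y ↦
    ((t : ℂ) ^ (((1 / 2 : ℂ) + y * I) - 1) • g t) * conj (M ((1 / 2 : ℂ) + y * I)) with hF
  -- Step 1: rewrite the left side as an iterated integral
  have h1 : ∫ t in Ioi (0 : ℝ), g t * conj (mellinInv (1 / 2) M t) =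
      ∫ t in Ioi (0 : ℝ), (1 / (2 * π) : ℂ) * ∫ y : ℝ, F t y :=
    setIntegral_congr_fun measurableSet_Ioi fun t ht ↦ mul_conj_mellinInv_eq g M ht
  rw [h1, integral_const_mul]
  congr 1
  -- Step 2: Fubini
  have hFint : Integrable (Function.uncurry F) (μ0.prod volume) := by
    -- measurability
    have hgm : AEStronglyMeasurable g μ0 := by
      have h := hg.aestronglyMeasurable
      -- `t ↦ t^{-1/2} • g t` measurable and `t^{-1/2} ≠ 0` on `Ioi 0`
      have h2 : AEStronglyMeasurable (fun t : ℝ ↦ (t : ℂ) ^ (-((1 / 2 : ℂ) - 1)) •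
          ((t : ℂ) ^ ((1 / 2 : ℂ) - 1) • g t)) μ0 :=
        (AEStronglyMeasurable.smul (by fun_prop : Measurable fun t : ℝ ↦
          (t : ℂ) ^ (-((1 / 2 : ℂ) - 1))).aestronglyMeasurable h)
      refine h2.congr ?_
      filter_upwards [ae_restrict_mem measurableSet_Ioi] with t (ht : 0 < t)
      have h0 : (t : ℂ) ≠ 0 := by exact_mod_cast ht.ne'
      rw [smul_smul, ← cpow_add _ _ h0, neg_add_cancel, cpow_zero, one_smul]
    have hmeas : AEStronglyMeasurable (Function.uncurry F) (μ0.prod volume) := by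
      have hc : Measurable fun p : ℝ × ℝ ↦ (p.1 : ℂ) ^ (((1 / 2 : ℂ) + p.2 * I) - 1) := by
        fun_prop
      have hg2 : AEStronglyMeasurable (fun p : ℝ × ℝ ↦ g p.1) (μ0.prod volume) := hgm.comp_fst
      have hM2 : AEStronglyMeasurable (fun p : ℝ × ℝ ↦ conj (M ((1 / 2 : ℂ) + p.2 * I)))
          (μ0.prod volume) := (continuous_conj.comp_aestronglyMeasurable hM.aestronglyMeasurable).comp_snd
      exact ((hc.aestronglyMeasurable.smul hg2).mul hM2).congr (Eventually.of_forall fun p ↦ rfl)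
    -- domination by a product of integrable functions
    have hdom : Integrable (fun p : ℝ × ℝ ↦ ‖(p.1 : ℂ) ^ ((1 / 2 : ℂ) - 1) • g p.1‖ *
        ‖M ((1 / 2 : ℂ) + p.2 * I)‖) (μ0.prod volume) := hg.norm.mul_prod hM.norm
    refine hdom.mono' hmeas ?_
    have hae : ∀ᵐ p : ℝ × ℝ ∂(μ0.prod volume), p.1 ∈ Ioi (0 : ℝ) :=
      (Measure.quasiMeasurePreserving_fst (μ := μ0) (ν := volume)).ae
        (ae_restrict_mem measurableSet_Ioi)
    filter_upwards [hae] with p hp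
    have ht : 0 < p.1 := hp
    simp only [Function.uncurry, hF, norm_mul, norm_smul, RCLike.norm_conj]
    rw [norm_cpow_eq_rpow_re_of_pos ht, norm_cpow_eq_rpow_re_of_pos ht]
    simp
  -- Step 3: swap and evaluate the inner integral
  rw [integral_integral_swap hFint]
  congr 1
  funext y
  simp only [hF]
  rw [integral_mul_const]
  rfl


/-- **Plancherel for the inverse Mellin transform of `L¹ ∩ L²` data on the critical line.** If
`τ ↦ M(1/2 + iτ)` is in `L¹ ∩ L²(ℝ)`, then `𝓜⁻¹M ∈ L²(0,∞)` and
`∫_0^∞ |(𝓜⁻¹M)(t)|² dt = (1/2π) ∫ |M(1/2+iτ)|² dτ` (Titchmarsh, *Fourier Integrals*, Thm. 71;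
here from `mellinInv = x^{-1/2} 𝓕⁻[…](-log x)` and Plancherel for `L¹ ∩ L²`,
`Literature.Analysis.FunctionSpaces.integral_norm_sq_fourierIntegral_eq`). [folklore] -/
theorem integral_norm_sq_mellinInv {M : ℂ → ℂ}
    (h1 : Integrable fun τ : ℝ ↦ M ((1 / 2 : ℂ) + τ * I))
    (h2 : MemLp (fun τ : ℝ ↦ M ((1 / 2 : ℂ) + τ * I)) 2) :
    MemLp (mellinInv (1 / 2) M) 2 (volume.restrict (Ioi 0)) ∧
      ∫ t in Ioi (0 : ℝ), ‖mellinInv (1 / 2) M t‖ ^ 2 =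
        (1 / (2 * π)) * ∫ τ : ℝ, ‖M ((1 / 2 : ℂ) + τ * I)‖ ^ 2 := by
  set m : ℝ → ℂ := fun τ ↦ M ((1 / 2 : ℂ) + τ * I) with hm
  set φ : ℝ → ℂ := fun y ↦ M ((1 / 2 : ℂ) + 2 * π * y * I) with hφ
  have h2π : (2 * π : ℝ) ≠ 0 := by positivity
  have hφm : φ = fun y ↦ m (2 * π * y) := by
    funext y; simp only [hφ, hm]; push_cast; ring_nf
  have hφ1 : Integrable φ := by rw [hφm]; exact h1.comp_mul_left' h2π
  have hφ2 : MemLp φ 2 := by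
    rw [hφm]
    refine (memLp_two_iff_integrable_sq_norm (h1.comp_mul_left' h2π).aestronglyMeasurable).2 ?_
    exact ((memLp_two_iff_integrable_sq_norm h2.1).1 h2).comp_mul_left' h2π
  -- `𝓕⁻ φ` is continuous and square integrable, with `∫ ‖𝓕⁻ φ‖² = ∫ ‖φ‖²`
  have hFcont : Continuous (𝓕⁻ φ) := by
    have : 𝓕⁻ φ = fun u ↦ 𝓕 φ (-u) := funext fun u ↦ Real.fourierInv_eq_fourier_neg φ u
    rw [this]
    exact (Literature.Analysis.FunctionSpaces.continuous_fourierIntegral hφ1).comp continuous_neg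
  have hFint : Integrable fun u : ℝ ↦ ‖𝓕⁻ φ u‖ ^ 2 := by
    have hF := Literature.Analysis.FunctionSpaces.memLp_two_fourierIntegral hφ1 hφ2
    have hi : Integrable (fun ξ : ℝ ↦ ‖𝓕 φ ξ‖ ^ 2) := (memLp_two_iff_integrable_sq_norm hF.1).1 hF
    refine (hi.comp_neg).congr (Eventually.of_forall fun u ↦ ?_)
    simp [Real.fourierInv_eq_fourier_neg]
  have hFeq : ∫ u : ℝ, ‖𝓕⁻ φ u‖ ^ 2 = (1 / (2 * π)) * ∫ τ : ℝ, ‖m τ‖ ^ 2 := by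
    have e1 : (fun u : ℝ ↦ ‖𝓕⁻ φ u‖ ^ 2) = fun u ↦ (fun v : ℝ ↦ ‖𝓕 φ v‖ ^ 2) (-u) := by
      funext u; simp [Real.fourierInv_eq_fourier_neg]
    rw [e1, integral_neg_eq_self (fun v : ℝ ↦ ‖𝓕 φ v‖ ^ 2) volume,
      Literature.Analysis.FunctionSpaces.integral_norm_sq_fourierIntegral_eq hφ1 hφ2, hφm,
      Measure.integral_comp_mul_left (fun τ : ℝ ↦ ‖m τ‖ ^ 2) (2 * π), smul_eq_mul,
      abs_of_pos (by positivity : (0 : ℝ) < (2 * π)⁻¹), one_div]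
  -- `𝓜⁻¹ M` on `(0,∞)` in terms of `𝓕⁻ φ`
  have hrepr : ∀ x : ℝ, 0 < x →
      mellinInv (1 / 2) M x = (x : ℂ) ^ (-(1 / 2 : ℂ)) • 𝓕⁻ φ (-Real.log x) := by
    intro x hx
    rw [mellinInv_eq_fourierInv _ _ hx]
    have e : (fun y : ℝ ↦ M (((1 / 2 : ℝ) : ℂ) + 2 * π * y * I)) = φ := by
      funext y; simp only [hφ]; push_cast; ring_nf
    rw [e]
    push_cast
    ring_nf
  have hnorm : ∀ u : ℝ, Real.exp (-u) • ‖mellinInv (1 / 2) M (Real.exp (-u))‖ ^ 2 =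
      ‖𝓕⁻ φ u‖ ^ 2 := by
    intro u
    have hx : 0 < Real.exp (-u) := Real.exp_pos _
    rw [hrepr _ hx, Real.log_exp, neg_neg, norm_smul, norm_cpow_eq_rpow_re_of_pos hx, smul_eq_mul,
      mul_pow]
    have : Real.exp (-u) * (Real.exp (-u) ^ (-(1 / 2 : ℂ)).re) ^ 2 = 1 := by
      rw [show (-(1 / 2 : ℂ)).re = -(1 / 2 : ℝ) by simp, ← Real.exp_mul, ← Real.exp_nat_mul,
        ← Real.exp_add]
      rw [show -u + ((2 : ℕ) : ℝ) * (-u * -(1 / 2)) = 0 by push_cast; ring, Real.exp_zero]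
    calc Real.exp (-u) * ((Real.exp (-u) ^ (-(1 / 2 : ℂ)).re) ^ 2 * ‖𝓕⁻ φ u‖ ^ 2)
        = (Real.exp (-u) * (Real.exp (-u) ^ (-(1 / 2 : ℂ)).re) ^ 2) * ‖𝓕⁻ φ u‖ ^ 2 := by ring
      _ = ‖𝓕⁻ φ u‖ ^ 2 := by rw [this, one_mul]
  -- square integrability on `(0,∞)`
  have hsq : IntegrableOn (fun t : ℝ ↦ ‖mellinInv (1 / 2) M t‖ ^ 2) (Ioi 0) := by
    rw [Literature.Analysis.FunctionSpaces.integrableOn_Ioi_iff_integrable_exp_neg_smul]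
    exact hFint.congr (Eventually.of_forall fun u ↦ (hnorm u).symm)
  have hmeas : AEStronglyMeasurable (mellinInv (1 / 2) M) (volume.restrict (Ioi 0)) := by
    have hc : ContinuousOn (fun x : ℝ ↦ (x : ℂ) ^ (-(1 / 2 : ℂ)) • 𝓕⁻ φ (-Real.log x)) (Ioi 0) := by
      intro x hx
      refine ContinuousAt.continuousWithinAt ?_
      have ha : ContinuousAt (fun x : ℝ ↦ (x : ℂ) ^ (-(1 / 2 : ℂ))) x :=
        Complex.continuousAt_ofReal_cpow_const x _ (Or.inr (ne_of_gt hx))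
      have hb : ContinuousAt (fun x : ℝ ↦ 𝓕⁻ φ (-Real.log x)) x :=
        hFcont.continuousAt.comp (ContinuousAt.neg (Real.continuousAt_log (ne_of_gt hx)))
      exact ha.smul hb
    refine (hc.aestronglyMeasurable measurableSet_Ioi).congr ?_
    filter_upwards [ae_restrict_mem measurableSet_Ioi] with x hx
    exact (hrepr x hx).symm
  refine ⟨(memLp_two_iff_integrable_sq_norm hmeas).2 hsq, ?_⟩
  rw [Literature.Analysis.FunctionSpaces.integral_Ioi_eq_integral_exp_neg_smul]
  simp_rw [hnorm]
  exact hFeq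

end BurnolVectors

end Literature.NumberTheory.LFunctions
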